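import Summits.CriticalPhenomena.SAWScalingLimit.Theses.SAWTotalPositivity
import Summits.CriticalPhenomena.SAWScalingLimit.Theorems.BoundaryTP2Negative_Midpoints

/-!
# Negative lemma for the crux `SAWTotalPositivity.TPToTraversalBound` (stmt-CriticalPhenomena-10687):
the sketch lemma `RimPushMonotone` (card `bad-slices-are-free`, ideator 3) is FALSE as typed

Refuter `cdisprove` (standing adversary, cycle 2; landed cycle 3); work file
`Summits/CriticalPhenomena/SAWScalingLimit/Cruxes/TPToTraversalBound/Disproof.lean` §7b, negative note
`Cruxes/TPToTraversalBound/NegativeRimPushMonotone.md`.  The refuted `Prop` is a VERBATIM copy of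
`Summit.CriticalPhenomena.SAWScalingLimit.Cruxes.TPToTraversalBound.Sketch.RimPushMonotone` with
`Sketch.Interlaced` (`Cruxes/TPToTraversalBound/Sketch.lean`, 2026-08-15; crux work files cannot be imported).

Witness: `Ω = Ω₃` (3 × 3 site box, from `BoundaryTP2Negative_Box3` / `_Midpoints`), `Ω' = Ω₂₃` (its left 2 × 3 sub-box), mesh
1, room `(m,d,d',m') = ((0,0),(0,1),(1,2),(1,0))`.  All provisos hold for trivial reasons (the corner `m` has only
the exits `d` and `m'`); with the certified exact kernels (complete enumeration: the tree's `Z₃_eq` and a 2 × 3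
clone `Z₂₃_eq`) the inequality reduces, after cancelling `(x+x³+2x⁵+4x⁷)(x+x³+x⁵)`, to `5x⁶(1-2x⁴) ≤ 0` — false
for every `0 < x < 2^{-1/4}`, in particular at `x = x_c ≤ 1/2` (ratio of the two sides 1.2031 at `x_c`).
Class: misstated — the intrinsic "hanging" proviso cannot tell a region hanging off the RIM from one hanging off
a WALL (here the wall `[m',d']`), where the card itself predicts the opposite sign; a repair must type the cyclic
boundary order (e.g. over `LatticeDobrushin` data) or restrict attachments to rim-side sites (triage r1-2).
Census (work-file folder, rimpush.py): 1,564 of 6,744 typed box ⊇ sub-box instances up to 5 × 4 violate it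
(worst ratio 1.45); triage r1-1/r1-2 found tens of thousands more (wall bumps at a post, kit j007474).
-/

namespace Summit.CriticalPhenomena.SAWScalingLimit.Theorems.TPToTraversalBound.Negative

open Summit.CriticalPhenomena.SAWScalingLimit.Theses.SAWTotalPositivity
open Literature.Probability.RandomPlanarGeometry Literature.Probability.LatticeModels MeasureTheory

section RimPushSection

open Summit.CriticalPhenomena.SAWScalingLimit.Theorems.BoundaryTP2.Negative
open scoped ENNReal


noncomputable section

/-- Copy of `Sketch.Z` (Cruxes/TPToTraversalBound/Sketch.lean, ideator 3) under the name `Zr` (the sibling file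
`AnnulusPairingGapFalse` declares `Z`): the critical SAW boundary kernel `Z_Ω(u,v)` (total mass of `SAW.weight`). -/
abbrev Zr (Ω : Set ℂ) (δ : ℝ) (u v : Site 2) : ENNReal := SAW.weight Ω δ u v Set.univ

/-- Verbatim copy of `Sketch.Interlaced` (ideator 3): the three intrinsic provisos of `BoundaryTP2`
for a cyclic quadruple. -/
def Interlaced (Ω : Set ℂ) (δ : ℝ) (p₁ p₂ p₃ p₄ : Site 2) : Prop :=
  (∀ (P : SAW.DomainSAW Ω δ p₁ p₃) (Q : SAW.DomainSAW Ω δ p₂ p₄),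
      ∃ v, v ∈ P.walk.support ∧ v ∈ Q.walk.support) ∧
  (∃ (P : SAW.DomainSAW Ω δ p₁ p₂) (Q : SAW.DomainSAW Ω δ p₃ p₄),
      List.Disjoint P.walk.support Q.walk.support) ∧
  (∃ (P : SAW.DomainSAW Ω δ p₁ p₄) (Q : SAW.DomainSAW Ω δ p₂ p₃),
      List.Disjoint P.walk.support Q.walk.support)

/-- Verbatim copy of `Sketch.RimPushMonotone` (card `bad-slices-are-free`, first lemma; "CONJECTURE,
numerically supported"), ideator 3, Cruxes/TPToTraversalBound/Sketch.lean as of 2026-08-15T23:38Z. -/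
def RimPushMonotone : Prop :=
  ∀ (Ω Ω' : Set ℂ) (δ : ℝ) (m d d' m' : Site 2),
    Bornology.IsBounded Ω → SimplyConnectedSpace Ω → SimplyConnectedSpace Ω' → Ω' ⊆ Ω → 0 < δ →
    Interlaced Ω' δ m d d' m' →
    (∀ (P : SAW.DomainSAW Ω δ m m'), (∃ v ∈ P.walk.support, v ∉ meshDomain Ω' δ) →
        ∀ (Q : SAW.DomainSAW Ω' δ d d'), ∃ v, v ∈ P.walk.support ∧ v ∈ Q.walk.support) →
    Zr Ω δ m d * Zr Ω δ m' d' * (Zr Ω' δ m m' * Zr Ω' δ d d') ≤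
      Zr Ω' δ m d * Zr Ω' δ m' d' * (Zr Ω δ m m' * Zr Ω δ d d')

/-! ### The 2 × 3 box `Ω₂₃` (clone of the tree's `Box3` bookkeeping) -/

/-- The 2 × 3 box of sites as a lattice Dobrushin datum. -/
def L₂₃ : LatticeDobrushin := LatticeDobrushin.ofBox ![0, 0] ![1, 2] ∅ (Set.empty_subset _)

/-- The 2 × 3 box domain `(-½, 3/2) × (-½, 5/2)`. -/
def Ω₂₃ : Set ℂ := siteDomain (boxSites ![0, 0] ![1, 2])

/-- `Ω₂₃` is simply connected. [folklore] -/
theorem simplyConnectedSpace_Ω₂₃ : SimplyConnectedSpace Ω₂₃ :=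
  simplyConnectedSpace_siteDomain_boxSites (Fin.forall_fin_two.2 ⟨by decide, by decide⟩)

/-- `Ω₂₃ ⊆ Ω₃`. [folklore] -/
theorem Ω₂₃_subset_Ω₃ : Ω₂₃ ⊆ Ω₃ := by
  intro z hz x hx
  have h := hz x hx
  rw [mem_boxSites_iff] at h ⊢
  intro i
  refine ⟨(h i).1, (h i).2.trans ?_⟩
  fin_cases i <;> simp

/-- The domain graph of `Ω₂₃` is `ℤ²` induced on the box. [folklore] -/
theorem adj₂₃_iff {x y : Site 2} : (discreteDomainGraph Ω₂₃ 1).Adj x y ↔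
    (zdGraph 2).Adj x y ∧ x ∈ boxSites ![0, 0] ![1, 2] ∧ y ∈ boxSites ![0, 0] ![1, 2] :=
  L₂₃.adj_iff

/-- The discrete domain of `Ω₂₃` is the box. [folklore] -/
theorem meshDomain_Ω₂₃ : meshDomain Ω₂₃ 1 = boxSites ![0, 0] ![1, 2] := L₂₃.meshDomain_eq

/-- Boolean membership in the 2 × 3 box. -/
def inBox₂₃ (x : Site 2) : Bool := decide (0 ≤ x 0) && decide (x 0 ≤ 1) && decide (0 ≤ x 1) && decide (x 1 ≤ 2)

/-- `inBox₂₃` is faithful. [folklore] -/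
theorem inBox₂₃_iff (x : Site 2) : inBox₂₃ x = true ↔ x ∈ boxSites ![0, 0] ![1, 2] := by
  simp only [inBox₂₃, Bool.and_eq_true, decide_eq_true_eq, mem_boxSites_iff, Fin.forall_fin_two,
    Matrix.cons_val_zero, Matrix.cons_val_one]
  tauto

/-- Candidate neighbours inside the 2 × 3 box, in the order E, W, N, S. -/
def nb₂₃ (u : Site 2) : List (Site 2) :=
  if inBox₂₃ u then [![u 0 + 1, u 1], ![u 0 - 1, u 1], ![u 0, u 1 + 1], ![u 0, u 1 - 1]].filter inBox₂₃ else []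

/-- `nb₂₃` lists all neighbours in the domain graph. [folklore] -/
theorem mem_nb₂₃ (u w : Site 2) (h : (discreteDomainGraph Ω₂₃ 1).Adj u w) : w ∈ nb₂₃ u := by
  rw [adj₂₃_iff] at h
  obtain ⟨hadj, hu, hw⟩ := h
  rw [nb₂₃, if_pos ((inBox₂₃_iff u).2 hu), List.mem_filter]
  refine ⟨?_, (inBox₂₃_iff w).2 hw⟩
  rcases zdGraph_adj_cases hadj with h | h | h | h <;> simp [h]

/-- `nb₂₃` lists only neighbours in the domain graph. [folklore] -/
theorem nb₂₃_adj (u w : Site 2) (h : w ∈ nb₂₃ u) : (discreteDomainGraph Ω₂₃ 1).Adj u w := by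
  unfold nb₂₃ at h
  split_ifs at h with hu
  · rw [List.mem_filter] at h
    refine adj₂₃_iff.2 ⟨zdGraph_adj_of_cases ?_, (inBox₂₃_iff u).1 hu, (inBox₂₃_iff w).1 h.2⟩
    simpa using h.1
  · simp at h

/-- The six sites of the box. -/
def T₂₃ : Finset (Site 2) := {![0, 0], ![0, 1], ![0, 2], ![1, 0], ![1, 1], ![1, 2]}

/-- `T₂₃` is the box. [folklore] -/
theorem mem_T₂₃_iff (x : Site 2) : x ∈ T₂₃ ↔ x ∈ boxSites ![0, 0] ![1, 2] := by
  constructor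
  · intro h
    simp only [T₂₃, Finset.mem_insert, Finset.mem_singleton] at h
    rw [mem_boxSites_iff, Fin.forall_fin_two]
    rcases h with rfl | rfl | rfl | rfl | rfl | rfl <;> simp
  · intro h
    rw [mem_boxSites_iff, Fin.forall_fin_two] at h
    simp only [Matrix.cons_val_zero, Matrix.cons_val_one] at h
    obtain ⟨⟨h0, h0'⟩, h1, h1'⟩ := h
    have hx : x = ![x 0, x 1] := funext (Fin.forall_fin_two.2 ⟨rfl, rfl⟩)
    rw [hx]
    simp only [T₂₃, Finset.mem_insert, Finset.mem_singleton]
    interval_cases (x 0) <;> interval_cases (x 1) <;> simp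

/-- The box has six sites. [folklore] -/
theorem card_T₂₃ : T₂₃.card ≤ 6 := by
  unfold T₂₃
  repeat (refine (Finset.card_insert_le _ _).trans (Nat.succ_le_succ ?_))
  simp

/-- Every SAW of `Ω₂₃` has at most `5` steps. [folklore] -/
theorem length_le_five {a b : Site 2} (ha : a ∈ boxSites ![0, 0] ![1, 2]) (γ : SAW.DomainSAW Ω₂₃ 1 a b) :
    γ.length ≤ 5 := by
  have h := length_lt_card_of_adj_mem T₂₃ (fun x y hxy => ?_) ((mem_T₂₃_iff a).2 ha) γ.walk γ.isPath
  · have := card_T₂₃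
    change γ.walk.length ≤ 5
    omega
  · rw [adj₂₃_iff] at hxy
    exact ⟨(mem_T₂₃_iff x).2 hxy.2.1, (mem_T₂₃_iff y).2 hxy.2.2⟩

/-- The fugacity-`x` two-point sum on `Ω₂₃`. -/
noncomputable def Z₂₃ (x : ℝ) (a b : Site 2) : ℝ≥0∞ := ∑' γ : SAW.DomainSAW Ω₂₃ 1 a b, ENNReal.ofReal (x ^ γ.length)

/-- At the critical fugacity, `Z₂₃` is the weight. [folklore] -/
theorem weight_Ω₂₃_eq_Z₂₃ (a b : Site 2) : SAW.weight Ω₂₃ 1 a b Set.univ = Z₂₃ SAW.criticalFugacity a b :=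
  weight_univ Ω₂₃ 1 a b

/-- Exact two-point sums on the 2 × 3 box by certified complete enumeration. [folklore] -/
theorem Z₂₃_eq {a b : Site 2} (ha : a ∈ boxSites ![0, 0] ![1, 2]) (lens : List ℕ)
    (hnodup : ((pathsFrom eqSite nb₂₃ 5 a []).filter (endsAt eqSite b)).Nodup)
    (hlens : ((pathsFrom eqSite nb₂₃ 5 a []).filter (endsAt eqSite b)).map (fun s => s.length - 1) = lens)
    {x : ℝ} (hx : 0 ≤ x) :
    Z₂₃ x a b = ENNReal.ofReal (lens.map fun k => x ^ k).sum := by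
  have hmap : (((pathsFrom eqSite nb₂₃ 5 a []).filter (endsAt eqSite b)).map
      fun s => ENNReal.ofReal (x ^ (s.length - 1))).sum = ENNReal.ofReal (lens.map fun k => x ^ k).sum := by
    rw [← sum_map_ofReal_pow hx, ← hlens, List.map_map]
    rfl
  refine le_antisymm ?_ ?_
  · rw [← hmap]
    exact tsum_pow_le_of_enum eqSite eqSite_iff nb₂₃ mem_nb₂₃ 5 (length_le_five ha) hnodup
  · rw [← hmap]
    exact sum_le_tsum_pow_of_enum eqSite eqSite_iff nb₂₃ nb₂₃_adj 5 hnodup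

/-! ### The eight exact kernels of the witness -/

/-- Exact kernel `Z₃((0,0),(0,1))` of the 3 × 3 box by certified complete enumeration (length list). [folklore] -/
theorem Z₃_00_01 {x : ℝ} (hx : 0 ≤ x) :
    Z₃ x ![0, 0] ![0, 1] = ENNReal.ofReal ([5, 7, 7, 7, 7, 3, 5, 1].map fun k => x ^ k).sum :=
  Z₃_eq (by decide) _ (by decide) (by decide) hx

/-- Exact kernel `Z₃((0,0),(1,0))`. [folklore] -/
theorem Z₃_00_10 {x : ℝ} (hx : 0 ≤ x) :
    Z₃ x ![0, 0] ![1, 0] = ENNReal.ofReal ([1, 5, 7, 3, 7, 7, 7, 5].map fun k => x ^ k).sum :=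
  Z₃_eq (by decide) _ (by decide) (by decide) hx

-- `Z₃_10_12` (exact kernel `Z₃((1,0),(1,2))`) is REUSED from `BoundaryTP2Negative_Midpoints`.

/-- Exact kernel `Z₃((0,1),(1,2))`. [folklore] -/
theorem Z₃_01_12 {x : ℝ} (hx : 0 ≤ x) :
    Z₃ x ![0, 1] ![1, 2] = ENNReal.ofReal ([4, 2, 6, 2, 6, 6, 6, 4].map fun k => x ^ k).sum :=
  Z₃_eq (by decide) _ (by decide) (by decide) hx

/-- Exact kernel `Z₂₃((0,0),(1,0))` of the 2 × 3 box. [folklore] -/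
theorem Z₂₃_00_10 {x : ℝ} (hx : 0 ≤ x) :
    Z₂₃ x ![0, 0] ![1, 0] = ENNReal.ofReal ([1, 3, 5].map fun k => x ^ k).sum :=
  Z₂₃_eq (by decide) _ (by decide) (by decide) hx

/-- Exact kernel `Z₂₃((0,1),(1,2))`. [folklore] -/
theorem Z₂₃_01_12 {x : ℝ} (hx : 0 ≤ x) :
    Z₂₃ x ![0, 1] ![1, 2] = ENNReal.ofReal ([2, 2, 4].map fun k => x ^ k).sum :=
  Z₂₃_eq (by decide) _ (by decide) (by decide) hx

/-- Exact kernel `Z₂₃((0,0),(0,1))`. [folklore] -/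
theorem Z₂₃_00_01 {x : ℝ} (hx : 0 ≤ x) :
    Z₂₃ x ![0, 0] ![0, 1] = ENNReal.ofReal ([3, 5, 1].map fun k => x ^ k).sum :=
  Z₂₃_eq (by decide) _ (by decide) (by decide) hx

/-- Exact kernel `Z₂₃((1,0),(1,2))`. [folklore] -/
theorem Z₂₃_10_12 {x : ℝ} (hx : 0 ≤ x) :
    Z₂₃ x ![1, 0] ![1, 2] = ENNReal.ofReal ([4, 4, 4, 2].map fun k => x ^ k).sum :=
  Z₂₃_eq (by decide) _ (by decide) (by decide) hx

/-! ### Explicit SAWs for the realisability provisos -/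

/-- An edge of `Ω₂₃` from decidable data. [folklore] -/
theorem adj₂₃ {x y : Site 2}
    (h : (zdGraph 2).Adj x y ∧ x ∈ boxSites ![0, 0] ![1, 2] ∧ y ∈ boxSites ![0, 0] ![1, 2]) :
    (discreteDomainGraph Ω₂₃ 1).Adj x y :=
  adj₂₃_iff.2 h

/-- SAW `(0,0) → (0,1)` of `Ω₂₃`. -/
def P_md : SAW.DomainSAW Ω₂₃ 1 ![0, 0] ![0, 1] :=
  ⟨.cons (adj₂₃ (by decide)) .nil, by simp [SimpleGraph.Walk.isPath_def]⟩

/-- SAW `(1,2) → (1,1) → (1,0)` of `Ω₂₃`. -/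
def Q_d'm' : SAW.DomainSAW Ω₂₃ 1 ![1, 2] ![1, 0] :=
  ⟨.cons (adj₂₃ (y := ![1, 1]) (by decide)) (.cons (adj₂₃ (by decide)) .nil), by
    simp [SimpleGraph.Walk.isPath_def]⟩

/-- SAW `(0,0) → (1,0)` of `Ω₂₃`. -/
def P_mm' : SAW.DomainSAW Ω₂₃ 1 ![0, 0] ![1, 0] :=
  ⟨.cons (adj₂₃ (by decide)) .nil, by simp [SimpleGraph.Walk.isPath_def]⟩

/-- SAW `(0,1) → (0,2) → (1,2)` of `Ω₂₃`. -/
def Q_dd' : SAW.DomainSAW Ω₂₃ 1 ![0, 1] ![1, 2] :=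
  ⟨.cons (adj₂₃ (y := ![0, 2]) (by decide)) (.cons (adj₂₃ (by decide)) .nil), by
    simp [SimpleGraph.Walk.isPath_def]⟩

end

/-- Disjointness of two explicit lists of sites from a Boolean certificate. [folklore] -/
theorem disjoint_of_all {l₁ l₂ : List (Site 2)}
    (h : (l₁.all fun a => l₂.all fun b => !(eqSite a b)) = true) : List.Disjoint l₁ l₂ := by
  intro a ha hb
  rw [List.all_eq_true] at h
  have h' := h a ha
  rw [List.all_eq_true] at h'
  have h'' := h' a hb
  have : eqSite a a = true := (eqSite_iff a a).2 rfl
  rw [this] at h''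
  exact Bool.false_ne_true h''

/-- The support of `P_md`. [folklore] -/
theorem support_P_md : P_md.walk.support = [![0, 0], ![0, 1]] := rfl

/-- The support of `Q_d'm'`. [folklore] -/
theorem support_Q_d'm' : Q_d'm'.walk.support = [![1, 2], ![1, 1], ![1, 0]] := rfl

/-- The support of `P_mm'`. [folklore] -/
theorem support_P_mm' : P_mm'.walk.support = [![0, 0], ![1, 0]] := rfl

/-- The support of `Q_dd'`. [folklore] -/
theorem support_Q_dd' : Q_dd'.walk.support = [![0, 1], ![0, 2], ![1, 2]] := rfl

/-- The second vertex of a SAW of `Ω₂₃` started at the corner `(0,0)` is `(1,0)` or `(0,1)`. [folklore] -/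
theorem second_vertex_Ω₂₃ {b : Site 2} (γ : SAW.DomainSAW Ω₂₃ 1 ![0, 0] b) (hb : b ≠ ![0, 0]) :
    γ.walk.getVert 1 ∈ γ.walk.support ∧ (γ.walk.getVert 1 = ![1, 0] ∨ γ.walk.getVert 1 = ![0, 1]) := by
  have hlen : γ.walk.length ≠ 0 := fun h0 => hb (γ.walk.eq_of_length_eq_zero h0).symm
  have hadj := γ.walk.adj_getVert_succ (i := 0) (Nat.pos_of_ne_zero hlen)
  rw [SimpleGraph.Walk.getVert_zero] at hadj
  refine ⟨SimpleGraph.Walk.getVert_mem_support _ _, ?_⟩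
  have hmem := mem_nb₂₃ _ _ hadj
  have hnb : nb₂₃ ![0, 0] = [![1, 0], ![0, 1]] := by decide
  rw [hnb] at hmem
  simpa using hmem

/-- The second vertex of a SAW of `Ω₃` started at the corner `(0,0)` is `(1,0)` or `(0,1)`. [folklore] -/
theorem second_vertex_Ω₃ {b : Site 2} (γ : SAW.DomainSAW Ω₃ 1 ![0, 0] b) (hb : b ≠ ![0, 0]) :
    γ.walk.getVert 1 ∈ γ.walk.support ∧ (γ.walk.getVert 1 = ![1, 0] ∨ γ.walk.getVert 1 = ![0, 1]) := by
  have hlen : γ.walk.length ≠ 0 := fun h0 => hb (γ.walk.eq_of_length_eq_zero h0).symm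
  have hadj := γ.walk.adj_getVert_succ (i := 0) (Nat.pos_of_ne_zero hlen)
  rw [SimpleGraph.Walk.getVert_zero] at hadj
  refine ⟨SimpleGraph.Walk.getVert_mem_support _ _, ?_⟩
  have hmem := mem_nb₃ _ _ hadj
  have hnb : nb₃ ![0, 0] = [![1, 0], ![0, 1]] := by decide
  rw [hnb] at hmem
  simpa using hmem

/-- **`RimPushMonotone` is FALSE as typed.**  Witness: `Ω = Ω₃` (3 × 3 box), `Ω' = Ω₂₃` (its left
2 × 3 sub-box), mesh 1, room `(m,d,d',m') = ((0,0),(0,1),(1,2),(1,0))`.  All provisos hold for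
trivial reasons (the corner `m` has only the two exits `d` and `m'`), and with the certified exact
kernels the inequality reduces, after cancelling the common factor
`Z₃(m,d)·Z₂₃(m,m') = Z₃(m,m')·Z₂₃(m,d) = (x+x³+2x⁵+4x⁷)(x+x³+x⁵)`, to
`(x²+6x⁴+2x⁶)(2x²+x⁴) ≤ (x²+3x⁴)(2x²+2x⁴+4x⁶)`, i.e. `5x⁶(1-2x⁴) ≤ 0` — false for every
`0 < x < 2^{-1/4}`, in particular at `x = x_c ≤ 1/2` (ratio of the two sides 1.2031 at x_c).
Class: misstated — the intrinsic "hanging" proviso does not see on which arc of the room the removed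
region `Ω ∖ Ω'` hangs (here it hangs off the WALL `[m',d']`, where the card itself predicts the
opposite monotonicity); a repair must type the rim/wall distinction (e.g. through the cyclic boundary
order of a `LatticeDobrushin` datum).  Small-graph census (this seat, rimpush.py): 1,564 of 6,744
typed box/sub-box instances up to 5 × 4 violate it, worst ratio 1.45. [folklore] -/
theorem not_rimPushMonotone : ¬ RimPushMonotone := by
  intro H
  have key := H Ω₃ Ω₂₃ 1 ![0, 0] ![0, 1] ![1, 2] ![1, 0] isBounded_Ω₃ simplyConnectedSpace_Ω₃
    simplyConnectedSpace_Ω₂₃ Ω₂₃_subset_Ω₃ one_pos ?_ ?_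
  rotate_left
  · -- Interlaced Ω₂₃ 1 m d d' m'
    refine ⟨fun P Q => ?_,
      ⟨P_md, Q_d'm', by rw [support_P_md, support_Q_d'm']; exact disjoint_of_all (by decide)⟩,
      ⟨P_mm', Q_dd', by rw [support_P_mm', support_Q_dd']; exact disjoint_of_all (by decide)⟩⟩
    obtain ⟨hmem, h | h⟩ := second_vertex_Ω₂₃ P (by decide)
    · exact ⟨P.walk.getVert 1, hmem, by rw [h]; exact Q.walk.end_mem_support⟩
    · exact ⟨P.walk.getVert 1, hmem, by rw [h]; exact Q.walk.start_mem_support⟩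
  · -- the hanging proviso
    intro P hP Q
    obtain ⟨hmem, h | h⟩ := second_vertex_Ω₃ P (by decide)
    · -- the second vertex is the end `m'`: the SAW is the single edge and stays inside the sub-box
      exfalso
      obtain ⟨v, hv, hv'⟩ := hP
      have hlen : P.walk.length = 1 := by
        have h1 : 1 ≤ P.walk.length := by
          have hlen0 : P.walk.length ≠ 0 := fun h0 => by
            have := P.walk.eq_of_length_eq_zero h0
            exact absurd (congrFun this 0) (by simp)
          omega
        exact ((P.isPath.getVert_eq_end_iff h1).1 h).symm
      rw [SimpleGraph.Walk.mem_support_iff_exists_getVert] at hv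
      obtain ⟨i, rfl, hi⟩ := hv
      rw [hlen] at hi
      apply hv'
      rw [meshDomain_Ω₂₃]
      interval_cases i
      · rw [SimpleGraph.Walk.getVert_zero]; decide
      · rw [h]; decide
    · exact ⟨P.walk.getVert 1, hmem, by rw [h]; exact Q.walk.start_mem_support⟩
  -- the inequality, with exact kernels
  have hx0 : 0 ≤ SAW.criticalFugacity := xc_nonneg
  have hxpos : 0 < SAW.criticalFugacity := SAW.criticalFugacity_pos_lt_one'.1
  have hxhalf : SAW.criticalFugacity ≤ 1 / 2 := SAW.criticalFugacity_le_half
  simp only [Zr, weight_Ω₃_eq_Z₃, weight_Ω₂₃_eq_Z₂₃, Z₃_00_01 hx0, Z₃_00_10 hx0, Z₃_10_12 hx0,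
    Z₃_01_12 hx0, Z₂₃_00_10 hx0, Z₂₃_01_12 hx0, Z₂₃_00_01 hx0, Z₂₃_10_12 hx0, List.map_cons,
    List.map_nil, List.sum_cons, List.sum_nil, add_zero] at key
  set x := SAW.criticalFugacity with hxdef
  -- collect the products of `ofReal`s
  rw [← ENNReal.ofReal_mul (by positivity), ← ENNReal.ofReal_mul (by positivity),
    ← ENNReal.ofReal_mul (by positivity), ← ENNReal.ofReal_mul (by positivity),
    ← ENNReal.ofReal_mul (by positivity), ← ENNReal.ofReal_mul (by positivity),
    ENNReal.ofReal_le_ofReal_iff (by positivity)] at key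
  have h4 : x ^ 4 ≤ 1 / 16 := by
    calc x ^ 4 ≤ (1 / 2) ^ 4 := pow_le_pow_left₀ hx0 hxhalf 4
      _ = 1 / 16 := by norm_num
  have hgap : 0 < 1 - 2 * x ^ 4 := by linarith
  nlinarith [mul_pos (mul_pos (mul_pos (by positivity : 0 < x + x ^ 3 + x ^ 5)
    (by positivity : 0 < x + x ^ 3 + 2 * x ^ 5 + 4 * x ^ 7)) (by positivity : 0 < 5 * x ^ 6)) hgap]


end RimPushSection

end Summit.CriticalPhenomena.SAWScalingLimit.Theorems.TPToTraversalBound.Negative
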